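import Literature.NumberTheory.Automorphic.HeckeDoubleCosetOperators   -- ★ `heckeAlgebra`, `heckeAlgebra.toVector`, `toVector_mul`, `toVector_injective`
import Mathlib.RingTheory.TensorProduct.Maps                           -- `Algebra.TensorProduct.rid`, `Algebra.TensorProduct.congr`
import Mathlib.LinearAlgebra.FreeModule.StrongRankCondition            -- `commRing_strongRankCondition`
import Mathlib.LinearAlgebra.Dimension.StrongRankCondition             -- `Module.finrank_self`
import HarnessLib

/-!
# R90 · S6 «Ch. 14.1–14.5 stable TF» — WAVE 7 card W7-c: THE HECKE ALGEBRA OF THE PAIR `(G, G)` IS THE BASE RING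
# `ℋ(G, G) = End_G(k[pt]) ≃ₐ[k] k` (`Theorems/R90S6HeckeAlgebraTop.lean`)

Cell `hodgecm-mathlib`, crux H413 (`stmt-HodgeConjecture-24833`), route `HCCMUnconditional`; programme R90-TF, section S6
(base `R90-C14`, dealer R90-C14-plan (g2)), seat R90-C14-p07 (g0); card W7-c (EMIT S6 WAVE 7, R90 bus 2026-09-04T23:08:14Z
∕ 23:14:13Z; menu `R90/R90-szE1.1/g3/CLOSURE-E1.1.md` §3, DAG row E1.3.4.1 «ℋ of the compact factors», feeding E1.3.4.4 ∕
E1.3.7.2 (the rank-one endoscopic maps `ξ̂_C`, `ξ̂` of [Rogawski1990, §4.9 Lemma 4.9.3 p. 56], where `C = U(1) × U(1) × U(1)`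
and the `U(1)` factors of `H = U(2) × U(1)` are COMPACT, so their hyperspecial subgroup is the whole group)).
Lane `--supports stmt-HodgeConjecture-24833 --as helper`; generic algebra over the tree's ★ `heckeAlgebra k G K = End_G(k[G ⧸ K])`
(`Literature/NumberTheory/Automorphic/HeckeAlgebra.lean` :91) and ★ `heckeAlgebra.toVector K T = T [K]`
(`HeckeDoubleCosetOperators.lean` :58); no instance, no notation, no named fact, no `sorry`; imports = ★ Literature + Mathlib + HarnessLib.

THE MATHEMATICS.  For a subgroup `K = ⊤` of a group `G` the coset space `G ⧸ K` is ONE point `[K]`, on which `G` acts trivially;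
hence the permutation representation `π = Representation.ofMulAction k G (G ⧸ K)` is the trivial representation on the free
rank-one module `k[G ⧸ K] = k · [K]` (`ofMulAction_quotient_eq_one_of_eq_top`), its commutant is EVERYTHING
(`heckeAlgebra_eq_top_of_eq_top : heckeAlgebra k G K = ⊤`), and the Frobenius-reciprocity coordinate
`T ↦ (T [K])([K])` (the value of the bi-`K`-invariant function of `T` at the single double coset `K 1 K = G`) is a
`k`-ALGEBRA ISOMORPHISM `heckeAlgebraAlgEquivOfEqTop : heckeAlgebra k G K ≃ₐ[k] k` with inverse the structure map
`c ↦ c · 1` (`heckeAlgebraAlgEquivOfEqTop_symm_apply`); as a function on `G ⧸ K` (hence on `G`) `T [K]` is the CONSTANT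
`heckeAlgebraAlgEquivOfEqTop T` (`coeff_toVector_of_eq_top`).  Specialisations: `heckeAlgebraTopAlgEquiv : heckeAlgebra k G ⊤ ≃ₐ[k] k`,
the card's key `heckeAlgebra_top_finrank_one : Module.finrank k (heckeAlgebra k G ⊤) = 1` (nontrivial `k`), and the corollary
used to drop a compact factor from a product, `tensorHeckeAlgebraAlgEquivOfEqTop : A ⊗[k] heckeAlgebra k G K ≃ₐ[k] A`
(`Algebra.TensorProduct.rid`), e.g. `ℋ(U(2)_w) ⊗ ℋ(U(1)_v, U(1)_v) ≅ ℋ(U(2)_w)`.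
The hypothesis is carried as `(hK : K = ⊤)` rather than the literal `⊤` so that consumers whose compact open subgroup is
PROVABLY everything (a hyperspecial subgroup of an anisotropic unitary group) apply the statements without transporting
`heckeAlgebra k G K` along `K = ⊤` (the two subalgebras live in different ambient endomorphism rings).
HONEST LABEL: generic Hecke-algebra bookkeeping [folklore; CartierCorvallis1979 §I.3 for `ℋ(G, K)` as bi-`K`-invariant functions];
proves no printed global statement, discharges no citation; count-neutral until the E1.3.4 ∕ E1.3.7 assemblies consume it.
HC_CM is proved only modulo the 7 printed citations (2 remaining named inputs: hLiu418 = stmt-HodgeConjecture-24832,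
h413 = stmt-HodgeConjecture-24833) until rung 0 closes.

## References
* [Rogawski1990] J. D. Rogawski, *Automorphic Representations of Unitary Groups in Three Variables*, Ann. of Math. Stud. 123 (1990), §4.9 Lemma 4.9.3 p. 56.
* [CartierCorvallis1979] P. Cartier, *Representations of 𝔭-adic groups: a survey*, PSPM 33.1 (1979), §I.3–I.4.
-/
set_option autoImplicit false
-- the mandated namespace repeats the single-problem summit's segment (`HodgeConjecture.HodgeConjecture`)
set_option linter.dupNamespace false

noncomputable section

open scoped TensorProduct
open MonoidAlgebra Representation
open Literature.NumberTheory.Automorphic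

namespace Summit.HodgeConjecture.HodgeConjecture.R90.S6

variable (k : Type*) {G : Type*} [CommRing k] [Group G] (K : Subgroup G)

/-! ### The coset space `G ⧸ K` is a point when `K = ⊤` -/

variable {K} in
/-- For `K = ⊤` the coset space `G ⧸ K` is a single point (Mathlib's `QuotientGroup.subsingleton_quotient_top`,
transported along `K = ⊤`). [folklore] -/
theorem subsingleton_quotient_of_eq_top (hK : K = ⊤) : Subsingleton (G ⧸ K) := by
  subst hK
  exact QuotientGroup.subsingleton_quotient_top

variable {K} in
/-- For `K = ⊤` every vector of `k[G ⧸ K]` is the multiple `v([K]) • [K]` of the basis vector of the trivial coset: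
`k[G ⧸ K] = k · [K]` is free of rank one on `[K]`. [folklore] -/
theorem eq_coeff_smul_single_of_eq_top (hK : K = ⊤) (v : MonoidAlgebra k (G ⧸ K)) :
    v = v.coeff ((1 : G) : G ⧸ K) • single ((1 : G) : G ⧸ K) (1 : k) := by
  haveI := subsingleton_quotient_of_eq_top hK
  refine MonoidAlgebra.ext (Finsupp.ext fun y => ?_)
  rw [Subsingleton.elim y ((1 : G) : G ⧸ K), coeff_smul_apply, coeff_single, Finsupp.single_eq_same,
    smul_eq_mul, mul_one]

variable {K} in
/-- For `K = ⊤` the group `G` acts TRIVIALLY on the point `G ⧸ K`, so the permutation representation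
`Representation.ofMulAction k G (G ⧸ K)` (`= c-Ind_K^G 𝟙 = 𝟙`) is the identity at every `g ∈ G`. [folklore] -/
theorem ofMulAction_quotient_eq_one_of_eq_top (hK : K = ⊤) (g : G) :
    ofMulAction k G (G ⧸ K) g = 1 := by
  haveI := subsingleton_quotient_of_eq_top hK
  refine MonoidAlgebra.lhom_ext' fun x => LinearMap.ext_ring ?_
  simp only [LinearMap.comp_apply, MonoidAlgebra.lsingle_apply, ofMulAction_single, Module.End.one_apply,
    Subsingleton.elim (g • x) x]

/-! ### `ℋ(G, K) = End_G(k[G ⧸ K])` is everything, and is `k` -/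

variable {K} in
/-- **For `K = ⊤` the Hecke algebra is the whole endomorphism algebra**: `ℋ(G, K) = End_G(k[G ⧸ K]) = End_k(k[pt])`, since the
`G`-action it must commute with is trivial (`ofMulAction_quotient_eq_one_of_eq_top`). [folklore] -/
theorem heckeAlgebra_eq_top_of_eq_top (hK : K = ⊤) : heckeAlgebra k G K = ⊤ := by
  refine eq_top_iff.2 fun T _ => (mem_heckeAlgebra_iff T).2 fun g => ?_
  rw [ofMulAction_quotient_eq_one_of_eq_top k hK g, one_mul, mul_one]

variable {K} in
/-- For `K = ⊤`, the vector `T [K] ∈ k[G ⧸ K]` of `T ∈ ℋ(G, K)` is `(T [K])([K]) • [K]`. [folklore] -/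
theorem toVector_eq_smul_single_of_eq_top (hK : K = ⊤) (T : heckeAlgebra k G K) :
    heckeAlgebra.toVector K T =
      (heckeAlgebra.toVector K T).coeff ((1 : G) : G ⧸ K) • single ((1 : G) : G ⧸ K) (1 : k) :=
  eq_coeff_smul_single_of_eq_top k hK _

variable {K} in
/-- For `K = ⊤`, every `T ∈ ℋ(G, K)` IS the scalar `(T [K])([K])`: `T = (T [K])([K]) • 1 = algebraMap k ℋ ((T [K])([K]))`
(both sides send `[K]` to the same vector, and `T ↦ T [K]` is injective by ★ `heckeAlgebra.toVector_injective`). [folklore] -/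
theorem eq_algebraMap_coeff_toVector_of_eq_top (hK : K = ⊤) (T : heckeAlgebra k G K) :
    T = algebraMap k (heckeAlgebra k G K) ((heckeAlgebra.toVector K T).coeff ((1 : G) : G ⧸ K)) := by
  apply heckeAlgebra.toVector_injective K
  rw [Algebra.algebraMap_eq_smul_one, map_smul, heckeAlgebra.toVector_one]
  exact toVector_eq_smul_single_of_eq_top k hK T

variable {K} in
/-- For `K = ⊤` the coordinate `T ↦ (T [K])([K])` is multiplicative: `((S T) [K])([K]) = (S [K])([K]) · (T [K])([K])`
(`(S T)[K] = S (T [K]) = (T [K])([K]) • S [K]`, ★ `heckeAlgebra.toVector_mul`). [folklore] -/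
theorem coeff_toVector_mul_of_eq_top (hK : K = ⊤) (S T : heckeAlgebra k G K) :
    (heckeAlgebra.toVector K (S * T)).coeff ((1 : G) : G ⧸ K) =
      (heckeAlgebra.toVector K S).coeff ((1 : G) : G ⧸ K) * (heckeAlgebra.toVector K T).coeff ((1 : G) : G ⧸ K) := by
  -- rewrite `T [K]` only inside the left-hand side (it also occurs on the right)
  conv_lhs => rw [heckeAlgebra.toVector_mul, toVector_eq_smul_single_of_eq_top k hK T, map_smul,
    ← heckeAlgebra.toVector_apply, coeff_smul_apply, smul_eq_mul, mul_comm]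

variable {K} in
/-- The coordinate of a scalar: `((c • 1) [K])([K]) = c`. [folklore] -/
theorem coeff_toVector_algebraMap (c : k) :
    (heckeAlgebra.toVector K (algebraMap k (heckeAlgebra k G K) c)).coeff ((1 : G) : G ⧸ K) = c := by
  rw [Algebra.algebraMap_eq_smul_one, map_smul, heckeAlgebra.toVector_one, coeff_smul_apply, coeff_single,
    Finsupp.single_eq_same, smul_eq_mul, mul_one]

variable {K} in
/-- **W7-c. For `K = ⊤` the Hecke algebra `ℋ(G, K) = End_G(k[G ⧸ K])` IS the base ring `k`**, by the `k`-algebra isomorphism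
`T ↦ (T [K])([K])` (the value of the bi-`K`-invariant function of `T` on the single double coset `K 1 K = G`), with inverse the
structure map `c ↦ c • 1`.  In print: the spherical Hecke algebra of a COMPACT group with respect to itself is `ℂ`
(the `U(1)` factors of `H = U(2) × U(1)` and `C = U(1)³` in [Rogawski1990, §4.9 Lemma 4.9.3]); Cartier's description of `ℋ(G, K)` as the
bi-`K`-invariant functions on the double cosets `K\G/K` — here ONE double coset. [cite: CartierCorvallis1979, §I.3] -/
def heckeAlgebraAlgEquivOfEqTop (hK : K = ⊤) : heckeAlgebra k G K ≃ₐ[k] k where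
  toFun T := (heckeAlgebra.toVector K T).coeff ((1 : G) : G ⧸ K)
  invFun c := algebraMap k (heckeAlgebra k G K) c
  left_inv T := (eq_algebraMap_coeff_toVector_of_eq_top k hK T).symm
  right_inv c := coeff_toVector_algebraMap k c
  map_mul' S T := coeff_toVector_mul_of_eq_top k hK S T
  map_add' S T := by rw [map_add, coeff_add, Finsupp.add_apply]
  commutes' c := coeff_toVector_algebraMap k c

variable {K} in
/-- Unfolding: `heckeAlgebraAlgEquivOfEqTop T = (T [K])([K])`. [folklore] -/
theorem heckeAlgebraAlgEquivOfEqTop_apply (hK : K = ⊤) (T : heckeAlgebra k G K) :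
    heckeAlgebraAlgEquivOfEqTop k hK T = (heckeAlgebra.toVector K T).coeff ((1 : G) : G ⧸ K) :=
  rfl

variable {K} in
/-- Unfolding of the inverse: `(heckeAlgebraAlgEquivOfEqTop)⁻¹ c = algebraMap k ℋ c = c • 1`. [folklore] -/
theorem heckeAlgebraAlgEquivOfEqTop_symm_apply (hK : K = ⊤) (c : k) :
    (heckeAlgebraAlgEquivOfEqTop k hK).symm c = algebraMap k (heckeAlgebra k G K) c :=
  rfl

variable {K} in
/-- **As a bi-`K`-invariant function, `T` is the CONSTANT `heckeAlgebraAlgEquivOfEqTop T`**: for `K = ⊤` every coefficient of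
`T [K] ∈ k[G ⧸ K]` (the function `gK ↦ (T [K])(gK)` on `G ⧸ K`, i.e. `g ↦ 𝟙`-weighted value on the one double coset `G`) equals
the coordinate of `T`. [folklore] -/
theorem coeff_toVector_of_eq_top (hK : K = ⊤) (T : heckeAlgebra k G K) (x : G ⧸ K) :
    (heckeAlgebra.toVector K T).coeff x = heckeAlgebraAlgEquivOfEqTop k hK T := by
  haveI := subsingleton_quotient_of_eq_top hK
  rw [Subsingleton.elim x ((1 : G) : G ⧸ K), heckeAlgebraAlgEquivOfEqTop_apply]

variable {K} in
/-- For `K = ⊤` and a nontrivial coefficient ring, `ℋ(G, K)` is free of rank one: `finrank_k ℋ(G, K) = 1`. [folklore] -/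
theorem finrank_heckeAlgebra_of_eq_top [Nontrivial k] (hK : K = ⊤) : Module.finrank k (heckeAlgebra k G K) = 1 := by
  rw [(heckeAlgebraAlgEquivOfEqTop k hK).toLinearEquiv.finrank_eq, Module.finrank_self]

/-! ### The literal `K = ⊤` specialisations (card key `heckeAlgebra_top_finrank_one`) -/

variable (G) in
/-- **`ℋ(G, G) ≃ₐ[k] k`**: the Hecke algebra of the pair `(G, ⊤)`, `End_G(k[G ⧸ ⊤]) = End_k(k[pt])`, is the base ring, by
`T ↦ (T [⊤])([⊤])` (specialisation of `heckeAlgebraAlgEquivOfEqTop` at the literal `⊤`). [cite: CartierCorvallis1979, §I.3] -/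
def heckeAlgebraTopAlgEquiv : heckeAlgebra k G (⊤ : Subgroup G) ≃ₐ[k] k :=
  heckeAlgebraAlgEquivOfEqTop k (K := (⊤ : Subgroup G)) rfl

variable (G) in
/-- Unfolding: `heckeAlgebraTopAlgEquiv T = (T [⊤])([⊤])`. [folklore] -/
theorem heckeAlgebraTopAlgEquiv_apply (T : heckeAlgebra k G (⊤ : Subgroup G)) :
    heckeAlgebraTopAlgEquiv k G T = (heckeAlgebra.toVector (⊤ : Subgroup G) T).coeff ((1 : G) : G ⧸ (⊤ : Subgroup G)) :=
  rfl

variable (G) in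
/-- **Card key W7-c `heckeAlgebra_top_finrank_one`: `finrank_k ℋ(G, G) = 1`** for a nontrivial commutative coefficient ring `k`
(every `K`-orbit on the point `G ⧸ ⊤` is the point; one double coset). [folklore] -/
theorem heckeAlgebra_top_finrank_one [Nontrivial k] : Module.finrank k (heckeAlgebra k G (⊤ : Subgroup G)) = 1 :=
  finrank_heckeAlgebra_of_eq_top k rfl

/-! ### Dropping a compact factor: `A ⊗ ℋ(G, G) ≃ₐ A` -/

variable {K} in
/-- **Corollary (dropping a factor whose level is everything)**: for any `k`-algebra `A` and `K = ⊤`,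
`A ⊗[k] ℋ(G, K) ≃ₐ[k] A` — `Algebra.TensorProduct.congr` with `heckeAlgebraAlgEquivOfEqTop`, then Mathlib's right unit
`Algebra.TensorProduct.rid`; on pure tensors `a ⊗ T ↦ (T [K])([K]) • a`.  In print: `ℋ(H_w) = ℋ(U(2)_w) ⊗ ℋ(U(1)_v) ≅ ℋ(U(2)_w)` for the
compact factor `U(1)_v` of `H = U(2) × U(1)`. [cite: Rogawski1990, §4.9 Lemma 4.9.3 p. 56] -/
def tensorHeckeAlgebraAlgEquivOfEqTop (A : Type*) [Semiring A] [Algebra k A] (hK : K = ⊤) :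
    A ⊗[k] heckeAlgebra k G K ≃ₐ[k] A :=
  (Algebra.TensorProduct.congr (AlgEquiv.refl : A ≃ₐ[k] A) (heckeAlgebraAlgEquivOfEqTop k hK)).trans
    (Algebra.TensorProduct.rid k k A)

variable {K} in
/-- On pure tensors: `tensorHeckeAlgebraAlgEquivOfEqTop (a ⊗ T) = (T [K])([K]) • a`. [folklore] -/
theorem tensorHeckeAlgebraAlgEquivOfEqTop_tmul (A : Type*) [Semiring A] [Algebra k A] (hK : K = ⊤) (a : A)
    (T : heckeAlgebra k G K) :
    tensorHeckeAlgebraAlgEquivOfEqTop k A hK (a ⊗ₜ[k] T) = heckeAlgebraAlgEquivOfEqTop k hK T • a :=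
  rfl

end Summit.HodgeConjecture.HodgeConjecture.R90.S6

end
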